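import Mathlib
import Summits.ValiantsHypothesis.ValiantsHypothesis.Theses.FreeSubtorus
import Summits.ValiantsHypothesis.ValiantsHypothesis.Cruxes.OrbitDimensionBound.Lines.ConfusionLadder
import Literature.Computability.AlgebraicComplexity.PBoundedGrowth
import Literature.Computability.AlgebraicComplexity.EquivariantDC

/-!
# Row-torus ladder — the ONE-SIDED rung above the proved floor `SubtorusCovering`

Forward generator G1 (`next-rung`, gen 2), unit `fwd2-rung-ValiantsHypothesis-01-g2`, host route
`route-ValiantsHypothesis-FreeSubtorus`, open crux advanced: `OrbitDimensionBound` (stmt-ValiantsHypothesis-16133).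

## Q1 FAMILY (one free parameter)
The family is the gen-1 family `CoveringRung ℓ` / `CoveringShadow ℓ` of `Lines/ConfusionLadder.lean`, indexed by a LOSS
`ℓ(n, r, Λ)`: "every `T_Λ`-equivariant affine determinantal representation of `per_n` (admissible `Λ`, `r` generators)
has size `m` with `C(n,⌊n/2⌋) ≤ m · ℓ`".  FLOOR = `ℓ = 2^r` (`coveringRung_powLoss`, PROVED = seed
`subtorusCovering_proof`).  SUMMIT end = any `ℓ` with `m·ℓ` p-bounded along a sequence contradicts VH only through the
symmetrisation crux; the asymptotic member `CoveringShadow ℓ` is implied by `VP ≠ VNP` for every `ℓ ≥ 1`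
(`coveringShadow_of_summit`).

## Q2 RUNG (this file): the ROW loss `ℓ_row(n, r, Λ) = 2^{rk_ℚ Λ_R}`
where `Λ_R = (Λ_i|rows)_i` are the ROW halves of the generators.  Always `1 ≤ ℓ_row ≤ 2^r` (`rk Λ_R ≤ r`), so
`RowRankCovering := CoveringRung ℓ_row` implies the floor (`subtorusCovering_of_rowRankCovering`) and
`RowShadow := CoveringShadow ℓ_row` — THE RUNG DECLARATION — is implied by the summit (`rowShadow_of_summit`) and implies
the floor's shadow (`powShadow_of_rowShadow`; the floor's shadow is itself a theorem, `powShadow_floor`).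
MEANING.  `T_Λ ⊇ T_{Λ_R} × {1}` (take `e = 1`; `rowTorus_le`), so the rung follows from — and is the loss-form of —
`OneSidedRowCovering`: a representation of `per_n` equivariant (exact lifts) under a ROW subtorus
`T_L × 1 = {x_{kl} ↦ d_k x_{kl} : d^{L_i} = 1}` (`L` zero-sum of ℚ-rank `ρ̄`) has size `m ≥ C(n,⌊n/2⌋) / 2^{ρ̄}`
(`rowRankCovering_of_oneSided`).  At `ρ̄ = 0` (`RowTorusCovering`): row-torus-equivariant representations of `per_n` have
size `≥ C(n,⌊n/2⌋)` — this contains the exponential lower bound for UNORDERED row-set-multilinear ABPs computing `per_n`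
(an ABP with node potentials is a row-torus-equivariant determinantal representation with exact diagonal lifts), the
recognised open "next frontier" past Kush's min-partition-rank barrier [Kush 2026, Cor. 1.3; CKSS 2024 §1].

## Q3/Q4 WHY THE FLOOR'S PROOF STOPS HERE
`Theorems/FreeSubtorusSubtorusCovering.lean` (pair sacrifice + `TorusBound` engine) and the engine
`BorderApolarityToricWitnessObstructionQPStubTorusBound.lean` (`torusBound_levelCount`) separate the `C(n,d)` pairs
`(I, σ I)` by the weights `γ₀ ∏_{k∈I} d_k e_{σ k}` of a generic TWO-sided element: distinct pairs have distinct weights by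
unique factorisation over the primes `p ⊔ q` (row AND column primes).  With no column torus (`e ≡ 1`) the served weight
`γ₀ ∏_{k∈I} d_k` forgets `J = σ(I)`: ONE row set `I` serves every `σ`, and `torusBound_served` then yields only `m ≥ n`.
The floor's extension step (`hcol'`/`hext`, N-th powers of the full two-sided torus on the residual block) has no column
characters to extend.  A one-sided count must see the LINEAR ALGEBRA between weight spaces (which row-`k` variables map
`E_w → E_{w+e_k}` and how `per_n` is assembled from these graded blocks), not just weight occupancy — exactly the content of
the line's stubs `stub_rowGradedForm` / `stub_gradedCount` (`Lines/row_torus.lean`).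

## Q5 it is a THEOREM SHAPE: `RowShadow`, `RowRankCovering`, `OneSidedRowCovering`, `RowTorusCovering` below; the crux-level
payoff is the RELAXED symmetrisation target `OrbitRowBound` (a row subtorus of codimension `≤ n/2`, NO column condition),
weaker than `OrbitDimensionBound` (`orbitRowBound_of_orbitDimensionBound`), with `closes_oneSided :
OrbitRowBound → OneSidedRowCovering → ValiantsHypothesis`.

References: [LandsbergRessayre2017] Landsberg–Ressayre, Thm. 2.8, Question 2.2; [Grenet2011];
[arXiv:2604.00746] D. Kush (2026), Cor. 1.3, §1 ("next frontier": unordered smABPs); [arXiv:2312.15874] Chatterjee–Kush–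
Saraf–Shpilka (CCC 2024) §1 (Arvind–Raja `2^{Ω(n/t)}`; sums of ordered smABPs); [Vonzurgathen1987] Thm. 3.1.
-/

set_option linter.dupNamespace false

noncomputable section

namespace Summit.ValiantsHypothesis.ValiantsHypothesis.Cruxes.OrbitDimensionBound.RowTorus

open Literature.Computability.AlgebraicComplexity
open Summit.ValiantsHypothesis.ValiantsHypothesis.Cruxes.OrbitDimensionBound.Confusion

/-! ## §1 Row data of a lattice and the row loss -/

/-- The ℚ-rank of a finite family of integer vectors `L : Fin ρ → ℤⁿ` (dimension of their ℚ-span). [folklore] -/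
def latticeRank (n ρ : ℕ) (L : Fin ρ → Fin n → ℤ) : ℕ :=
  Set.finrank ℚ (Set.range fun i : Fin ρ => fun k : Fin n => (L i k : ℚ))

/-- The ROW halves `Λ_R` of two-sided lattice data `Λ : Fin r → ℤⁿ ⊕ ℤⁿ`. [cite: LandsbergRessayre2017, §6] -/
def rowPart {n r : ℕ} (Λ : Fin r → (Fin n ⊕ Fin n) → ℤ) : Fin r → Fin n → ℤ :=
  fun i k => Λ i (Sum.inl k)

/-- The row rank `rk_ℚ Λ_R`. [cite: LandsbergRessayre2017, §6] -/
def rowRank (n r : ℕ) (Λ : Fin r → (Fin n ⊕ Fin n) → ℤ) : ℕ :=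
  latticeRank n r (rowPart Λ)

/-- **The row loss** `ℓ_row(n, r, Λ) = 2^{rk_ℚ Λ_R}` — the rung's parameter value. [cite: LandsbergRessayre2017, §6] -/
def rowLoss : Loss := fun n r Λ => 2 ^ rowRank n r Λ

theorem latticeRank_le (n ρ : ℕ) (L : Fin ρ → Fin n → ℤ) : latticeRank n ρ L ≤ ρ := by
  have h := finrank_range_le_card (R := ℚ) (fun i : Fin ρ => fun k : Fin n => (L i k : ℚ))
  simpa [latticeRank] using h

theorem latticeRank_zero (n : ℕ) (L : Fin 0 → Fin n → ℤ) : latticeRank n 0 L = 0 :=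
  Nat.le_zero.1 (latticeRank_le n 0 L)

theorem rowRank_le (n r : ℕ) (Λ : Fin r → (Fin n ⊕ Fin n) → ℤ) : rowRank n r Λ ≤ r :=
  latticeRank_le n r (rowPart Λ)

theorem one_le_rowLoss (n r : ℕ) (Λ : Fin r → (Fin n ⊕ Fin n) → ℤ) : 1 ≤ rowLoss n r Λ :=
  Nat.one_le_two_pow

theorem rowLoss_le_powLoss (n r : ℕ) (Λ : Fin r → (Fin n ⊕ Fin n) → ℤ) : rowLoss n r Λ ≤ powLoss n r Λ :=
  Nat.pow_le_pow_right (by norm_num) (rowRank_le n r Λ)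

/-! ## §2 The rung: numeric member and asymptotic shadow -/

/-- **Numeric rung `RowRankCovering`** = `CoveringRung ℓ_row`: for `n ≥ 3`, every affine determinantal representation of
`per_n` of size `m`, equivariant (exact lifts) under an admissible `T_Λ`, satisfies `C(n,⌊n/2⌋) ≤ m · 2^{rk_ℚ Λ_R}` — the
exponent counts only the ROW relations. [cite: LandsbergRessayre2017, Thm. 2.8, Question 2.2] -/
def RowRankCovering : Prop := CoveringRung rowLoss

/-- **THE RUNG (asymptotic member) `RowShadow`** = `CoveringShadow ℓ_row`: along any sequence of admissible lattice data
`Λ_n` and `T_{Λ_n}`-equivariant affine determinantal representations `B_n` of `per_n` of sizes `m_n`, the function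
`n ↦ m_n · 2^{rk_ℚ (Λ_n)_R}` is not p-bounded. [cite: LandsbergRessayre2017, Question 2.2] -/
def RowShadow : Prop := CoveringShadow rowLoss

/-- rung ⇒ floor (numeric): `ℓ_row ≤ 2^r`. [cite: LandsbergRessayre2017, Thm. 2.8] -/
theorem subtorusCovering_of_rowRankCovering (h : RowRankCovering) :
    Summit.ValiantsHypothesis.ValiantsHypothesis.Theses.FreeSubtorus.SubtorusCovering :=
  coveringRung_powLoss_iff.1 (CoveringRung.mono (fun n r Λ => rowLoss_le_powLoss n r Λ) h)

/-- numeric rung ⇒ asymptotic rung (middle binomial not p-bounded, tree `not_isPBounded_choose_middle`). [folklore] -/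
theorem rowShadow_of_rowRankCovering (h : RowRankCovering) : RowShadow :=
  coveringShadow_of_coveringRung not_isPBounded_choose_middle h

/-- Shadows are monotone in the loss. [folklore] -/
theorem coveringShadow_mono {ℓ ℓ' : Loss} (hle : ∀ n r Λ, ℓ n r Λ ≤ ℓ' n r Λ) (h : CoveringShadow ℓ) :
    CoveringShadow ℓ' := by
  intro m r Λ B hyp hP
  exact h m r Λ B hyp (hP.mono fun n => Nat.mul_le_mul_left _ (hle n (r n) (Λ n)))

/-- rung ⇒ floor (asymptotic): `RowShadow → CoveringShadow 2^r`. [folklore] -/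
theorem powShadow_of_rowShadow (h : RowShadow) : CoveringShadow powLoss :=
  coveringShadow_mono (fun n r Λ => rowLoss_le_powLoss n r Λ) h

/-- The floor's shadow is a THEOREM (floor proved + binomial growth). [cite: LandsbergRessayre2017, Thm. 2.8] -/
theorem powShadow_floor : CoveringShadow powLoss :=
  coveringShadow_of_coveringRung not_isPBounded_choose_middle coveringRung_powLoss

/-- **ON PATH: `S → RowShadow`** (`1 ≤ 2^{rk}`; one line from `coveringShadow_of_summit`).
[cite: LandsbergRessayre2017, Question 2.2] -/
@[aesop safe apply]
theorem rowShadow_of_summit (hS : _root_.ValiantsHypothesis) : RowShadow :=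
  coveringShadow_of_summit (fun n r Λ _ => one_le_rowLoss n r Λ) hS

/-! ## §3 The one-sided (row subtorus) statements -/

/-- The ROW subtorus `T_L × 1 ⊆ GL(n²)`: substitutions `x_{kl} ↦ d_k x_{kl}` with `d^{L_i} = 1` for all `i`
(generated subgroup; exact-lift equivariance is w.r.t. its elements). [cite: LandsbergRessayre2017, §6] -/
def rowTorus (n ρ : ℕ) (L : Fin ρ → Fin n → ℤ) : Subgroup (GL (Fin n × Fin n) ℂ) :=
  Subgroup.closure {γ : Matrix.GeneralLinearGroup (Fin n × Fin n) ℂ |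
    ∃ d : Fin n → ℂˣ, (∀ i, (∏ k, (d k) ^ (L i k)) = 1) ∧
      (γ : Matrix (Fin n × Fin n) (Fin n × Fin n) ℂ) = Matrix.diagonal (fun p => (d p.1 : ℂ))}

/-- **`OneSidedRowCovering`** (the line's hub statement): for `n ≥ 3`, an affine determinantal representation of `per_n`
of size `m`, equivariant under the row subtorus `T_L × 1` (`L` zero-sum, `ρ` generators), has
`C(n,⌊n/2⌋) ≤ m · 2^{rk_ℚ L}`. [cite: LandsbergRessayre2017, Thm. 2.8, Question 2.2] -/
def OneSidedRowCovering : Prop :=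
  ∀ n : ℕ, 3 ≤ n → ∀ (m ρ : ℕ) (L : Fin ρ → Fin n → ℤ)
    (B : Matrix (Fin m) (Fin m) (MvPolynomial (Fin n × Fin n) ℂ)),
    (∀ i, (∑ k, L i k) = 0) →
    IsEquivariantDetRepr (rowTorus n ρ L) (perPoly (Fin n) ℂ) B →
    Nat.choose n (n / 2) ≤ m * 2 ^ latticeRank n ρ L

/-- **`RowTorusCovering`** (`ρ = 0`): a representation of `per_n` equivariant under the FULL row torus
`x_{kl} ↦ d_k x_{kl}` has size `≥ C(n,⌊n/2⌋)`.  Contains the exponential lower bound for unordered row-set-multilinear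
ABPs computing `per_n`. [cite: LandsbergRessayre2017, Question 2.2] -/
def RowTorusCovering : Prop :=
  ∀ n : ℕ, 3 ≤ n → ∀ (m : ℕ) (B : Matrix (Fin m) (Fin m) (MvPolynomial (Fin n × Fin n) ℂ)),
    IsEquivariantDetRepr (rowTorus n 0 (fun i => i.elim0)) (perPoly (Fin n) ℂ) B →
    Nat.choose n (n / 2) ≤ m

theorem rowTorusCovering_of_oneSided (h : OneSidedRowCovering) : RowTorusCovering := by
  intro n hn m B hB
  have h' := h n hn m 0 (fun i => i.elim0) B (fun i => i.elim0) hB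
  simpa [latticeRank_zero] using h'

/-- `T_{Λ_R} × 1 ≤ T_Λ`: a row element satisfying the row relations, paired with `e = 1`, satisfies the two-sided
relations. [cite: LandsbergRessayre2017, §6] -/
theorem rowTorus_le (n r : ℕ) (Λ : Fin r → (Fin n ⊕ Fin n) → ℤ) :
    rowTorus n r (rowPart Λ) ≤
      Subgroup.closure {γ : Matrix.GeneralLinearGroup (Fin n × Fin n) ℂ |
        ∃ d e : Fin n → ℂˣ, (∀ i, (∏ k, (d k) ^ (Λ i (Sum.inl k))) * (∏ l, (e l) ^ (Λ i (Sum.inr l))) = 1) ∧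
          (γ : Matrix (Fin n × Fin n) (Fin n × Fin n) ℂ) = Matrix.diagonal (fun p => (d p.1 : ℂ) * (e p.2 : ℂ))} := by
  refine Subgroup.closure_mono ?_
  rintro γ ⟨d, hd, hγ⟩
  refine ⟨d, fun _ => 1, fun i => ?_, ?_⟩
  · simpa [rowPart] using hd i
  · simpa using hγ

/-- **one-sided ⇒ rung (numeric)**: restrict the symmetry from `T_Λ` to `T_{Λ_R} × 1`. [cite: LandsbergRessayre2017, §6] -/
theorem rowRankCovering_of_oneSided (h : OneSidedRowCovering) : RowRankCovering := by
  intro n hn m r Λ B hΛ hB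
  exact h n hn m r (rowPart Λ) B (fun i => (hΛ i).1) (hB.anti (rowTorus_le n r Λ))

/-- **one-sided ⇒ RUNG**. [cite: LandsbergRessayre2017, Question 2.2] -/
theorem rowShadow_of_oneSided (h : OneSidedRowCovering) : RowShadow :=
  rowShadow_of_rowRankCovering (rowRankCovering_of_oneSided h)

/-! ## §4 The relaxed symmetrisation target and the closing -/

/-- **`OrbitRowBound`** (relaxed crux #1): every affine determinantal representation of `per_n` (`n ≥ 3`) of size `m` can
be replaced by one of the same size that is equivariant (exact lifts) under a ROW subtorus `T_L × 1` with `L` zero-sum of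
ℚ-rank `≤ ⌊n/2⌋` — no column symmetry is asked.  Weaker than `OrbitDimensionBound`. [cite: LandsbergRessayre2017, Question 2.2] -/
def OrbitRowBound : Prop :=
  ∀ n : ℕ, 3 ≤ n → ∀ (m : ℕ) (A : Matrix (Fin m) (Fin m) (MvPolynomial (Fin n × Fin n) ℂ)),
    IsAffineDetRepr (perPoly (Fin n) ℂ) A →
    ∃ (B : Matrix (Fin m) (Fin m) (MvPolynomial (Fin n × Fin n) ℂ)) (ρ : ℕ) (L : Fin ρ → Fin n → ℤ),
      2 ^ latticeRank n ρ L ≤ 2 ^ (n / 2) ∧ (∀ i, (∑ k, L i k) = 0) ∧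
      IsEquivariantDetRepr (rowTorus n ρ L) (perPoly (Fin n) ℂ) B

/-- `OrbitDimensionBound ⇒ OrbitRowBound` (`rk Λ_R ≤ r ≤ n/2`, `T_{Λ_R} × 1 ≤ T_Λ`). [cite: LandsbergRessayre2017, Question 2.2] -/
theorem orbitRowBound_of_orbitDimensionBound
    (h : Summit.ValiantsHypothesis.ValiantsHypothesis.Theses.FreeSubtorus.OrbitDimensionBound) : OrbitRowBound := by
  intro n hn m A hA
  obtain ⟨B, r, Λ, hr, hΛ, hB⟩ := h n hn m A hA
  refine ⟨B, r, rowPart Λ, ?_, fun i => (hΛ i).1, hB.anti (rowTorus_le n r Λ)⟩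
  exact Nat.pow_le_pow_right (by norm_num) ((latticeRank_le n r (rowPart Λ)).trans hr)

/-- **The relaxed closing `OrbitRowBound → OneSidedRowCovering → VP ≠ VNP`** (via the ladder's `vh_of_middle_bound`:
`C(n,⌊n/2⌋) ≤ dc(per_n)·2^{⌊n/2⌋}` ⇒ VH). [cite: LandsbergRessayre2017, Thm. 2.8, Question 2.2]
[cite: BurgisserClausenShokrollahi1997, Cor. (21.40)] -/
theorem closes_oneSided (h₁ : OrbitRowBound) (h₂ : OneSidedRowCovering) : _root_.ValiantsHypothesis := by
  refine vh_of_middle_bound fun n hn => ?_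
  obtain ⟨A, hA⟩ := hasDetRepr_determinantalComplexity_holds (perPoly (Fin n) ℂ)
  obtain ⟨B, ρ, L, hrk, hL, hB⟩ := h₁ n hn _ A hA
  exact (h₂ n hn _ ρ L B hL hB).trans (Nat.mul_le_mul_left _ hrk)

/-- For comparison, the floor's closing with the relaxed target is NOT available (a row subtorus is not an admissible
`T_Λ`); the host's own closing from the floor is `Confusion.closes_floor`. The rung's numeric member closes with the
ORIGINAL crux: `OrbitDimensionBound → RowRankCovering → VH`. [cite: LandsbergRessayre2017, Thm. 2.8] -/
theorem closes_rung (h₁ : Summit.ValiantsHypothesis.ValiantsHypothesis.Theses.FreeSubtorus.OrbitDimensionBound)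
    (h₂ : RowRankCovering) : _root_.ValiantsHypothesis :=
  Summit.ValiantsHypothesis.ValiantsHypothesis.Theses.FreeSubtorus.closes h₁ (subtorusCovering_of_rowRankCovering h₂)

end Summit.ValiantsHypothesis.ValiantsHypothesis.Cruxes.OrbitDimensionBound.RowTorus

end
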